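import Literature.NumberTheory.Kottwitz1992.InvolutionsLemma22Holds
import HarnessLib

/-!
# [Kottwitz1992, Lemma 2.3 (3) p. 380] A positive involution stays positive on a stable semisimple subalgebra — DISCHARGED:
# `Kottwitz1992_2_3_3_subalgebra_holds`

Kernel-lane companion of the statement carpet ★ `Literature/NumberTheory/Kottwitz1992/Involutions.lean` (squad TK; builds on ★
`InvolutionsLemma22Holds`, Lemma 2.2): the named fact ★ `Involutions.Kottwitz1992_2_3_3_subalgebra` — «If `*` is a positive involution of `B`
leaving stable a semisimple subalgebra `C` of `B`, then `*` induces a positive involution of `C`» (the stable subalgebra presented by an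
injective `ℝ`-algebra map `f : C → B` with `f (ι_C c) = ι (f c)`) — is PROVED here.  THEOREMS ONLY (no definition, no named fact, no `sorry`,
no instance, no notation); cell hodgecm-mathlib, seat B-typ02 (g31); net debt −1.

R. E. Kottwitz, *Points on some Shimura varieties over finite fields*, J. Amer. Math. Soc. 5 (1992), Lemma 2.3 (3) p. 380, proof p. 380
L20–L21 (held `paper:doi-10-2307-2152772`, p0008 L15–L21).  THE PRINTED PROOF: «To prove (3) choose a faithful positive definite Hermitian
`B`-module.  Then `V` is a faithful positive definite Hermitian `C`-module.»  Formalised through the equivalent conditions of Lemma 2.2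
(★ `Kottwitz1992_2_2_tfae_holds`): `B` itself, a `C`-module through `f`, has `tr(x x* ; B) = tr_{B/ℝ}(f(x) f(x)*) > 0` for `x ≠ 0` (positivity of
`*` on `B`, `f` injective) — condition (4) for `(C, ι_C)` — whence condition (3), the positivity of `ι_C`; `C` is finite-dimensional because `f`
is injective and semisimple by hypothesis, and `ι_C` inherits the involution identities through `f`.
HONEST LABEL: HC_CM is proved only modulo the 7 printed citations (2 remaining: hLiu418, h413) until rung 0 closes; this file adds no citation
debt (0 facts, 0 sorry) and discharges 1 named fact of ★ `Involutions`.

## References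
* [Kottwitz1992] R. E. Kottwitz, Points on some Shimura varieties over finite fields, J. Amer. Math. Soc. 5 (1992) 373–444, Lemma 2.3 p. 380.
-/

namespace Literature.NumberTheory.Kottwitz1992.Involutions

open Literature.NumberTheory.Automorphic (leftMulTrace leftMulTrace_apply)

universe u

variable {B : Type u} [Ring B] [Algebra ℝ B] (ι : B →ₗ[ℝ] B)
variable (C : Type u) [Ring C] [Algebra ℝ C] (ιC : C →ₗ[ℝ] C) (f : C →ₐ[ℝ] B)

/-- **LEMMA 2.3 (3), PROVED**: ★ `Kottwitz1992_2_3_3_subalgebra` holds — for a positive involution `*` of the finite-dimensional semisimple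
`ℝ`-algebra `B` and an injective `ℝ`-algebra map `f : C → B` from a semisimple `C` intertwining `ι_C` with `*`, `ι_C` is a positive involution:
`B` is a `C`-module through `f` with `tr(x ι_C(x) ; B) = tr_{B/ℝ}(f(x) f(x)*) > 0` for `x ≠ 0` (condition (4) of Lemma 2.2 for `C`), so condition
(3) holds by ★ `Kottwitz1992_2_2_tfae_holds`. [cite: Kottwitz1992, Lemma 2.3 (3) (p. 380)] -/
theorem Kottwitz1992_2_3_3_subalgebra_holds : Kottwitz1992_2_3_3_subalgebra B ι C ιC f := by
  intro hA hP hC hf hcomp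
  haveI := hA.finiteDimensional
  have hI : IsInvolution ℝ B ι := hP.toIsInvolution
  -- `ι_C` is an involution: the identities are checked after applying the injective `f`
  have hmul : ∀ x y : C, ιC (x * y) = ιC y * ιC x := fun x y => hf (by
    calc f (ιC (x * y)) = ι (f x * f y) := by rw [hcomp, map_mul f]
      _ = ι (f y) * ι (f x) := hI.map_mul _ _
      _ = f (ιC y * ιC x) := by rw [map_mul f, hcomp, hcomp])
  have happ : ∀ x : C, ιC (ιC x) = x := fun x => hf (by rw [hcomp, hcomp, hI.apply_apply])
  -- `C` is finite-dimensional (`f` injective) and semisimple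
  haveI : FiniteDimensional ℝ C := Module.Finite.of_injective f.toLinearMap hf
  haveI := hC
  have hAC : IsAlgebraWithInvolution C ιC := ⟨inferInstance, hC, ⟨hmul, happ⟩⟩
  -- `B` as a `C`-module through `f`: condition (4) of Lemma 2.2 for `(C, ι_C)`
  letI : Module C B := Module.compHom B f.toRingHom
  have hsmul : ∀ (c : C) (b : B), c • b = f c * b := fun c b => rfl
  haveI : IsScalarTower ℝ C B := ⟨fun r c b => by rw [hsmul, hsmul, map_smul f r c, smul_mul_assoc]⟩
  haveI : Module.Finite C B := Module.Finite.of_restrictScalars_finite ℝ C B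
  have h4 : ExistsModuleTraceMulSelfPos C ιC := by
    refine ⟨B, inferInstance, inferInstance, inferInstance, inferInstance, inferInstance, fun x hx => ?_⟩
    have heq : moduleTrace C B (x * ιC x) = leftMulTrace ℝ B (f x * ι (f x)) := by
      simp only [moduleTrace, leftMulTrace_apply]
      congr 1
      refine LinearMap.ext fun b => ?_
      simp [hsmul, hcomp]
    rw [heq]
    exact hP.trace_mul_self_pos _ fun h0 => hx (hf (by rw [h0, map_zero]))
  have h3 : TraceMulSelfPos C ιC := ((Kottwitz1992_2_2_tfae_holds ιC hAC).out 3 2).mp h4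
  exact ⟨⟨hmul, happ⟩, h3⟩

end Literature.NumberTheory.Kottwitz1992.Involutions
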